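import Mathlib

/-!
# `MatrixDescartes` census — twisted Rolle and the trinomial lemma (tools for the Newton cone C25)

HONEST FRAMING.  Object-search cell `pub-symmetroid`, route crux `Theses.LacunarySymmetroid.MatrixDescartes`
(ledger item stmt-ValiantsHypothesis-18050).  Elementary real-root tools, used by the companion file
`…CensusNewtonCone.lean` to put the cell's structural statement C25 («Newton cone») into the kernel:

* TWISTED ROLLE: `#Z₊(f) ≤ #Z₊(X·f′ − E·f) + 1` for every real polynomial `f` and real weight `E`
  (`card_posRoots_le_card_posRoots_twist_succ`: Rolle's theorem for `u ↦ f(u)·u^{−E}` between consecutive positive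
  roots; the Euler twist acts diagonally on monomials, `coeff_X_mul_derivative_sub_C_mul`), iterated over a finite
  set of killed exponents of a fewnomial (`card_posRoots_le_card_posRoots_twists`);
* the TRINOMIAL LEMMA (`trinomial_two_posRoots_le`): two distinct positive roots of `A Xⁱ + B X^{i+a} + C X^{i+a+b}`
  force `(a+b)^{a+b} |A|^b |C|^a ≤ |B|^{a+b} a^a b^b` (weighted AM–GM `amgm_pow_nat` at a root when the outer
  coefficients have the same sign; strict monotonicity `inv_pow_add_pow_strictMono` otherwise).

`Z₊(f)` is written, as everywhere in the census files, `(f.roots.toFinset.filter (0 < ·)).card` (distinct positive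
roots; the zero polynomial has none).  Nothing here bears on the crux `MatrixDescartes` or on `VP ≠ VNP`.

[folklore] Rolle, Descartes-type counting, weighted AM–GM; no single source.
-/

-- `Summit.ValiantsHypothesis.ValiantsHypothesis.…` repeats a component by the D-0017 layout
-- (single-conjunct summit), which the `dupNamespace` linter flags; the name is mandated.
set_option linter.dupNamespace false

namespace Summit.ValiantsHypothesis.ValiantsHypothesis.Theorems.LacunarySymmetroidMatrixDescartes.Census

open Polynomial Finset
open scoped BigOperators Polynomial
/-- Coefficients of the Euler twist `X·f′ − E·f`: the twist acts diagonally on monomials,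
`coeff (X f′ − E f) n = (n − E) · coeff f n`. [folklore] -/
theorem coeff_X_mul_derivative_sub_C_mul (f : ℝ[X]) (E : ℝ) (n : ℕ) :
    (X * derivative f - C E * f).coeff n = ((n : ℝ) - E) * f.coeff n := by
  rcases n with _ | k
  · simp
  · rw [coeff_sub, coeff_X_mul, coeff_derivative, coeff_C_mul]
    push_cast
    ring

/-- **Twisted Rolle.**  For a real polynomial `f` and a real «weight» `E`, the Euler twist
`X·f′ − E·f` has at least as many distinct POSITIVE roots as `f`, less one:
`#Z₊(f) ≤ #Z₊(X f′ − E f) + 1`.  (Rolle's theorem applied to `u ↦ f(u)·u^(−E)` between consecutive positive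
roots of `f`; when the twist vanishes identically `f` is a monomial and has no positive root.) [folklore] -/
theorem card_posRoots_le_card_posRoots_twist_succ (f : ℝ[X]) (E : ℝ) :
    (f.roots.toFinset.filter (fun x => 0 < x)).card ≤
      ((X * derivative f - C E * f).roots.toFinset.filter (fun x => 0 < x)).card + 1 := by
  rcases eq_or_ne f 0 with rfl | hf
  · simp
  rcases eq_or_ne (X * derivative f - C E * f) 0 with hg | hg
  · -- the twist vanishes: `(n − E) · coeff f n = 0` for all `n`, so `f = c · X ^ natDegree f`, no positive root
    have hcoef : ∀ n, n ≠ f.natDegree → f.coeff n = 0 := by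
      intro n hn
      have h1 := coeff_X_mul_derivative_sub_C_mul f E n
      have h2 := coeff_X_mul_derivative_sub_C_mul f E f.natDegree
      rw [hg, coeff_zero] at h1 h2
      have hlead : f.coeff f.natDegree ≠ 0 := by
        rw [coeff_natDegree]; exact leadingCoeff_ne_zero.mpr hf
      have hE : (f.natDegree : ℝ) - E = 0 := by
        rcases mul_eq_zero.mp h2.symm with h | h
        · exact h
        · exact absurd h hlead
      rcases mul_eq_zero.mp h1.symm with h | h
      · exfalso; apply hn
        have : (n : ℝ) = f.natDegree := by linarith
        exact_mod_cast this
      · exact h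
    have hempty : f.roots.toFinset.filter (fun x => 0 < x) = ∅ := by
      refine Finset.eq_empty_of_forall_notMem fun x hx => ?_
      rw [Finset.mem_filter, Multiset.mem_toFinset, mem_roots hf, IsRoot.def,
        eval_eq_sum_range, Finset.sum_eq_single f.natDegree] at hx
      · rcases hx with ⟨h0, hxpos⟩
        rcases mul_eq_zero.mp h0 with h | h
        · exact (leadingCoeff_ne_zero.mpr hf) (by rwa [coeff_natDegree] at h)
        · exact absurd h (pow_ne_zero _ hxpos.ne')
      · intro n _ hn; rw [hcoef n hn, zero_mul]
      · intro h; exact absurd (Finset.mem_range.mpr (Nat.lt_succ_self _)) h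
    rw [hempty]; simp
  refine Finset.card_le_of_interleaved fun x hx y hy hxy _ => ?_
  simp only [Finset.mem_filter, Multiset.mem_toFinset, mem_roots hf, IsRoot.def] at hx hy
  obtain ⟨hfx, hx0⟩ := hx
  obtain ⟨hfy, hy0⟩ := hy
  -- Rolle for `h u = f(u) · exp (−E · log u)` on `[x, y] ⊂ (0, ∞)`
  have hder : ∀ u ∈ Set.Ioo x y, HasDerivAt (fun u => f.eval u * Real.exp (-E * Real.log u))
      ((derivative f).eval u * Real.exp (-E * Real.log u) +
        f.eval u * (Real.exp (-E * Real.log u) * (-E * u⁻¹))) u := by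
    intro u hu
    have hu0 : u ≠ 0 := (hx0.trans hu.1).ne'
    refine (f.hasDerivAt u).mul ?_
    exact ((Real.hasDerivAt_log hu0).const_mul (-E)).exp
  have hcont : ContinuousOn (fun u => f.eval u * Real.exp (-E * Real.log u)) (Set.Icc x y) := by
    refine f.continuousOn.mul (Real.continuous_exp.comp_continuousOn
      ((continuousOn_const.mul (Real.continuousOn_log.mono ?_))))
    intro u hu; exact (hx0.trans_le hu.1).ne'
  obtain ⟨z, hz, hz0⟩ := exists_hasDerivAt_eq_zero hxy hcont (by simp [hfx, hfy]) hder
  have hz0' : 0 < z := hx0.trans hz.1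
  refine ⟨z, ?_, hz.1, hz.2⟩
  simp only [Finset.mem_filter, Multiset.mem_toFinset, mem_roots hg, IsRoot.def, eval_sub, eval_mul, eval_X,
    eval_C]
  refine ⟨?_, hz0'⟩
  have hexp : 0 < Real.exp (-E * Real.log z) := Real.exp_pos _
  -- `hz0 : f' z · w + f z · (w · (−E z⁻¹)) = 0`, `w > 0`  ⇒  `z f' z − E f z = 0`
  have hzne : z ≠ 0 := hz0'.ne'
  have key : Real.exp (-E * Real.log z) * (z * (derivative f).eval z - E * f.eval z)
      = ((derivative f).eval z * Real.exp (-E * Real.log z) +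
          f.eval z * (Real.exp (-E * Real.log z) * (-E * z⁻¹))) * z := by
    field_simp
    ring
  rw [hz0, zero_mul] at key
  rcases mul_eq_zero.mp key with h | h
  · exact absurd h hexp.ne'
  · linarith [h]


/-- The Euler twist of a sum of monomials: `X·(∑ aₜ X^{eₜ})′ − E·∑ aₜ X^{eₜ} = ∑ aₜ (eₜ − E) X^{eₜ}`.
[folklore] -/
theorem twist_sum_C_mul_X_pow {n : ℕ} (e : Fin n → ℕ) (a : Fin n → ℝ) (E : ℝ) :
    X * derivative (∑ t, C (a t) * X ^ (e t)) - C E * (∑ t, C (a t) * X ^ (e t))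
      = ∑ t, C (a t * ((e t : ℝ) - E)) * X ^ (e t) := by
  ext k
  rw [coeff_X_mul_derivative_sub_C_mul, finsetSum_coeff, finsetSum_coeff, Finset.mul_sum]
  refine Finset.sum_congr rfl fun t _ => ?_
  simp only [coeff_C_mul, coeff_X_pow]
  split_ifs with h
  · subst h; ring
  · ring

/-- **Iterated twisted Rolle on a fewnomial.**  Killing the exponents `e u`, `u ∈ U`, one Euler twist at a
time turns `∑ₜ cₜ X^{eₜ}` into `∑ₜ cₜ (∏_{u ∈ U} (eₜ − e_u)) X^{eₜ}` and loses at most `#U` distinct positive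
roots. [folklore] -/
theorem card_posRoots_le_card_posRoots_twists {n : ℕ} (e : Fin n → ℕ) (c : Fin n → ℝ)
    (U : Finset (Fin n)) :
    ((∑ t, C (c t) * X ^ (e t)).roots.toFinset.filter (fun x => 0 < x)).card ≤
      ((∑ t, C (c t * ∏ u ∈ U, ((e t : ℝ) - e u)) * X ^ (e t)).roots.toFinset.filter
        (fun x => 0 < x)).card + U.card := by
  induction U using Finset.induction_on with
  | empty => simp
  | insert u U hu ih =>
    rw [Finset.card_insert_of_notMem hu]
    have step := card_posRoots_le_card_posRoots_twist_succ
      (∑ t, C (c t * ∏ u' ∈ U, ((e t : ℝ) - e u')) * X ^ (e t)) (e u)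
    rw [twist_sum_C_mul_X_pow] at step
    have hsum : (∑ t, C (c t * (∏ u' ∈ U, ((e t : ℝ) - e u')) * ((e t : ℝ) - e u)) * X ^ (e t))
        = ∑ t, C (c t * ∏ u' ∈ insert u U, ((e t : ℝ) - e u')) * X ^ (e t) := by
      refine Finset.sum_congr rfl fun t _ => ?_
      rw [Finset.prod_insert hu]
      ring_nf
    rw [hsum] at step
    omega

/-- Weighted AM–GM with natural weights, product form: for `P, Q ≥ 0` and positive naturals `a, b`,
`(a+b)^(a+b) · P^b · Q^a ≤ (P+Q)^(a+b) · a^a · b^b` (equality iff `a·P = b·Q`). [folklore] -/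
theorem amgm_pow_nat {a b : ℕ} (ha : 0 < a) (hb : 0 < b) {P Q : ℝ} (hP : 0 ≤ P) (hQ : 0 ≤ Q) :
    ((a : ℝ) + b) ^ (a + b) * P ^ b * Q ^ a ≤ (P + Q) ^ (a + b) * (a : ℝ) ^ a * (b : ℝ) ^ b := by
  have ha' : (0 : ℝ) < a := by exact_mod_cast ha
  have hb' : (0 : ℝ) < b := by exact_mod_cast hb
  set s : ℝ := (a : ℝ) + b with hs
  have hs0 : 0 < s := by positivity
  -- weighted AM–GM with weights b/s, a/s at the points s/b·P, s/a·Q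
  have key := Real.geom_mean_le_arith_mean2_weighted (w₁ := b / s) (w₂ := a / s)
    (p₁ := s / b * P) (p₂ := s / a * Q) (by positivity) (by positivity) (by positivity) (by positivity)
    (by rw [hs]; field_simp; ring)
  have hrhs : b / s * (s / b * P) + a / s * (s / a * Q) = P + Q := by
    field_simp
  rw [hrhs] at key
  -- raise to the power a + b
  have hl : 0 ≤ (s / b * P) ^ (b / s) * (s / a * Q) ^ (a / s) := by positivity
  have key2 := pow_le_pow_left₀ hl key (a + b)
  have hnat : ((s / b * P) ^ (b / s) * (s / a * Q) ^ (a / s)) ^ (a + b)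
      = (s / b * P) ^ b * (s / a * Q) ^ a := by
    rw [mul_pow, ← Real.rpow_natCast ((s / b * P) ^ (b / s)), ← Real.rpow_natCast ((s / a * Q) ^ (a / s)),
      ← Real.rpow_mul (by positivity), ← Real.rpow_mul (by positivity)]
    have h1 : b / s * ((a + b : ℕ) : ℝ) = (b : ℕ) := by rw [hs]; push_cast; field_simp
    have h2 : a / s * ((a + b : ℕ) : ℝ) = (a : ℕ) := by rw [hs]; push_cast; field_simp
    rw [h1, h2, Real.rpow_natCast, Real.rpow_natCast]
  rw [hnat, mul_pow, mul_pow, div_pow, div_pow] at key2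
  -- key2 : s^b / b^b * P^b * (s^a / a^a * Q^a) ≤ (P + Q)^(a+b)
  have hbb : (0 : ℝ) < (b : ℝ) ^ b := by positivity
  have haa : (0 : ℝ) < (a : ℝ) ^ a := by positivity
  rw [show ((a : ℝ) + b) ^ (a + b) = s ^ a * s ^ b by rw [hs, pow_add]]
  have := mul_le_mul_of_nonneg_right key2 (le_of_lt (mul_pos haa hbb))
  calc s ^ a * s ^ b * P ^ b * Q ^ a
      = s ^ b / (b : ℝ) ^ b * P ^ b * (s ^ a / (a : ℝ) ^ a * Q ^ a) * ((a : ℝ) ^ a * (b : ℝ) ^ b) := by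
        field_simp
    _ ≤ (P + Q) ^ (a + b) * ((a : ℝ) ^ a * (b : ℝ) ^ b) := this
    _ = (P + Q) ^ (a + b) * (a : ℝ) ^ a * (b : ℝ) ^ b := by ring

/-- Strict monotonicity used by the trinomial lemma: for `A < 0 < Cc` the function
`x ↦ A·x⁻ᵃ + Cc·xᵇ` (`a, b ≥ 1`) is strictly increasing on `(0, ∞)`. [folklore] -/
theorem inv_pow_add_pow_strictMono {a b : ℕ} (ha : 0 < a) (hb : 0 < b) {A Cc : ℝ} (hA : A < 0)
    (hC : 0 < Cc) {x y : ℝ} (hx : 0 < x) (hxy : x < y) :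
    A * x⁻¹ ^ a + Cc * x ^ b < A * y⁻¹ ^ a + Cc * y ^ b := by
  have hy : 0 < y := hx.trans hxy
  have h1 : y⁻¹ ^ a < x⁻¹ ^ a :=
    pow_lt_pow_left₀ ((inv_lt_inv₀ hy hx).mpr hxy) (le_of_lt (inv_pos.mpr hy)) ha.ne'
  have h2 : x ^ b < y ^ b := pow_lt_pow_left₀ hxy hx.le hb.ne'
  nlinarith [mul_lt_mul_of_neg_left h1 hA, mul_lt_mul_of_pos_left h2 hC]

/-- **Trinomial lemma (the base of the Newton cone).**  If the real trinomial
`A·Xⁱ + B·X^{i+a} + Cc·X^{i+a+b}` (`a, b ≥ 1`) has at least two distinct positive roots, then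
`(a+b)^{a+b} · |A|^b · |Cc|^a ≤ |B|^{a+b} · a^a · b^b` — the classical condition for a trinomial to have two
positive roots (weighted AM–GM at a root when the outer coefficients have the same sign; when they have opposite
signs `x ↦ A x⁻ᵃ + Cc xᵇ` is strictly monotone and there is at most one positive root). [folklore] -/
theorem trinomial_two_posRoots_le {i a b : ℕ} (ha : 0 < a) (hb : 0 < b) (A B Cc : ℝ)
    (h2 : 1 < ((C A * X ^ i + C B * X ^ (i + a) + C Cc * X ^ (i + a + b)).roots.toFinset.filter
      (fun x => 0 < x)).card) :
    ((a : ℝ) + b) ^ (a + b) * |A| ^ b * |Cc| ^ a ≤ |B| ^ (a + b) * (a : ℝ) ^ a * (b : ℝ) ^ b := by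
  -- trivial when an outer coefficient vanishes
  by_cases hA : A = 0
  · subst hA
    rw [abs_zero, zero_pow hb.ne', mul_zero, zero_mul]
    positivity
  by_cases hC : Cc = 0
  · subst hC
    rw [abs_zero, zero_pow ha.ne', mul_zero]
    positivity
  have hg0 : C A * X ^ i + C B * X ^ (i + a) + C Cc * X ^ (i + a + b) ≠ 0 := by
    intro h; rw [h] at h2; simp at h2
  obtain ⟨x₁, hx₁, x₂, hx₂, hne⟩ := Finset.one_lt_card.mp h2
  simp only [Finset.mem_filter, Multiset.mem_toFinset, mem_roots hg0, IsRoot.def, eval_add,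
    eval_mul, eval_C, eval_pow, eval_X] at hx₁ hx₂
  -- the root relation divided by `x^{i+a}`: `A x⁻ᵃ + B + Cc xᵇ = 0`
  have rel : ∀ x : ℝ, 0 < x → A * x ^ i + B * x ^ (i + a) + Cc * x ^ (i + a + b) = 0 →
      A * x⁻¹ ^ a + B + Cc * x ^ b = 0 := by
    intro x hx h
    have hxne : x ≠ 0 := hx.ne'
    have hxa : x ^ a ≠ 0 := pow_ne_zero _ hxne
    have hxia : x ^ (i + a) ≠ 0 := pow_ne_zero _ hxne
    have key : x ^ (i + a) * (A * x⁻¹ ^ a + B + Cc * x ^ b)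
        = A * x ^ i + B * x ^ (i + a) + Cc * x ^ (i + a + b) := by
      rw [inv_pow, pow_add, pow_add, pow_add]
      calc x ^ i * x ^ a * (A * (x ^ a)⁻¹ + B + Cc * x ^ b)
          = A * x ^ i * (x ^ a * (x ^ a)⁻¹) + B * (x ^ i * x ^ a) + Cc * (x ^ i * x ^ a * x ^ b) := by
            ring
        _ = A * x ^ i + B * (x ^ i * x ^ a) + Cc * (x ^ i * x ^ a * x ^ b) := by
            rw [mul_inv_cancel₀ hxa, mul_one]
    exact (mul_eq_zero.mp (key.trans h)).resolve_left hxia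
  have r₁ := rel x₁ hx₁.2 hx₁.1
  have r₂ := rel x₂ hx₂.2 hx₂.1
  rcases lt_or_gt_of_ne (mul_ne_zero hA hC) with hneg | hpos
  · -- opposite signs: strictly monotone, so the two roots coincide — contradiction
    exfalso
    have key : ∀ {A' C' : ℝ}, A' < 0 → 0 < C' →
        A' * x₁⁻¹ ^ a + C' * x₁ ^ b = A' * x₂⁻¹ ^ a + C' * x₂ ^ b → False := by
      intro A' C' hA' hC' h
      rcases lt_or_gt_of_ne hne with hlt | hgt
      · exact (inv_pow_add_pow_strictMono ha hb hA' hC' hx₁.2 hlt).ne h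
      · exact (inv_pow_add_pow_strictMono ha hb hA' hC' hx₂.2 hgt).ne h.symm
    rcases lt_or_gt_of_ne hA with hA' | hA'
    · have hC' : 0 < Cc := by nlinarith
      exact key hA' hC' (by linarith)
    · have hC' : Cc < 0 := by nlinarith
      exact key (A' := -A) (C' := -Cc) (by linarith) (by linarith) (by linarith)
  · -- same signs: `|B| = |A| x₁⁻ᵃ + |Cc| x₁ᵇ`, then AM–GM
    have hx := hx₁.2
    have hP : 0 ≤ |A| * x₁⁻¹ ^ a := by positivity
    have hQ : 0 ≤ |Cc| * x₁ ^ b := by positivity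
    have hB : |B| = |A| * x₁⁻¹ ^ a + |Cc| * x₁ ^ b := by
      have hB' : B = -(A * x₁⁻¹ ^ a + Cc * x₁ ^ b) := by linarith
      rw [hB', abs_neg]
      rcases lt_or_gt_of_ne hA with hA' | hA'
      · have hC' : Cc < 0 := by nlinarith
        have h1 : A * x₁⁻¹ ^ a ≤ 0 := mul_nonpos_of_nonpos_of_nonneg hA'.le (by positivity)
        have h2 : Cc * x₁ ^ b ≤ 0 := mul_nonpos_of_nonpos_of_nonneg hC'.le (by positivity)
        rw [abs_of_nonpos (by linarith), abs_of_neg hA', abs_of_neg hC']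
        ring
      · have hC' : 0 < Cc := by nlinarith
        have h1 : 0 ≤ A * x₁⁻¹ ^ a := by positivity
        have h2 : 0 ≤ Cc * x₁ ^ b := by positivity
        rw [abs_of_nonneg (by linarith), abs_of_pos hA', abs_of_pos hC']
    have am := amgm_pow_nat ha hb hP hQ
    rw [← hB] at am
    have hxne : x₁ ≠ 0 := hx.ne'
    have hone : (x₁⁻¹ ^ a) ^ b * (x₁ ^ b) ^ a = 1 := by
      rw [← pow_mul, ← pow_mul, mul_comm b a, ← mul_pow, inv_mul_cancel₀ hxne, one_pow]
    have hprod : (|A| * x₁⁻¹ ^ a) ^ b * (|Cc| * x₁ ^ b) ^ a = |A| ^ b * |Cc| ^ a := by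
      calc (|A| * x₁⁻¹ ^ a) ^ b * (|Cc| * x₁ ^ b) ^ a
          = |A| ^ b * |Cc| ^ a * ((x₁⁻¹ ^ a) ^ b * (x₁ ^ b) ^ a) := by ring
        _ = |A| ^ b * |Cc| ^ a := by rw [hone, mul_one]
    calc ((a : ℝ) + b) ^ (a + b) * |A| ^ b * |Cc| ^ a
        = ((a : ℝ) + b) ^ (a + b) * (|A| * x₁⁻¹ ^ a) ^ b * (|Cc| * x₁ ^ b) ^ a := by
          rw [mul_assoc, ← hprod, ← mul_assoc]
      _ ≤ |B| ^ (a + b) * (a : ℝ) ^ a * (b : ℝ) ^ b := am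


end Summit.ValiantsHypothesis.ValiantsHypothesis.Theorems.LacunarySymmetroidMatrixDescartes.Census
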